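import Summits.Ventures.CertifiedQuantumChemistry.Rows.DifferenceRows
import HarnessLib

/-!
# Ventures/CertifiedQuantumChemistry — Rows/DifferenceDecisions.lean: what a certified DIFFERENCE row
# DECIDES — the SIGN / ORDERING of a reaction step, a THRESHOLD decision, and the confidence-class
# arithmetic of ORACLE-SPEC §1.5 (sibling of `Rows/DifferenceRows.lean`, nothing there is edited)

HONEST FRAMING (verbatim): certified bounds for a stated model Hamiltonian in a stated basis; not a
claim about the real molecule or material beyond that model. A decision below is a statement about
the two MODEL energies `E₀(F_A; a, b)`, `E₀(F_B; a′, b′)`; the map model → reality (BUDGET.md) is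
VALIDATED, never certified, and can reverse a certified model-level ordering (chem-model-1's PAIR.md:
the print's composite order of two isomers is the OPPOSITE of the active-space order).

Typer chem-type-01 (LADDER-CHEM cell chem-oracle, I-TYPE; own line = the difference-row vocabulary of
`Rows/DifferenceRows.lean`), zero compute; theorems + two decidable slot predicates; nothing is asserted
about any file; no claim node, no instance, no notation.

WHY. The cell's first transition-metal difference row (ROW α1, director-chem 2026-08-26T19:47:22Z:
«this is the first certified reaction-energy SIGN within reach in the programme … any certified
U_HC ≤ −4733.80 certifies the ORDERING E₀(HFe2;XS) > E₀(HC;XS)») is valuable for its SIGN long before its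
width reaches a decision threshold, and the oracle's answer schema (ORACLE-SPEC §1.5 / §2.4) classifies
every bracket against a threshold `θ`: «`certified-informative` ⇔ a two-sided certified bracket on
ΔE_model with width ≤ the query's decision threshold θ; `certified-loose` ⇔ certified two-sided with
width > θ, or one-sided». The row predicates `DiffLowerRow` / `DiffUpperRow` / `DiffBracket` state
inequalities; this file spells out, once, the DECISIONS they license, so that a claim-node file can
conclude «`E₀(B) < E₀(A)`» or «`ΔE < τ`» by name and chem-ref-4 can lint the words «ordering certified» /
«certified-informative» against a decl:

* §1 SIGN / ORDERING: `DiffLowerRow.lt_of_pos` (`0 < lo` ⇒ `E₀(F_B; a′,b′) < E₀(F_A; a,b)`),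
  `DiffUpperRow.lt_of_neg` (`hi < 0` ⇒ `E₀(F_A) < E₀(F_B)`), the non-strict forms, the bracket
  forms `DiffBracket.lt_of_pos/neg`, and the exhaustive case split `DiffBracket.sign_trichotomy`
  (positive / negative / `DiffBracket.StraddlesZero lo hi` — a bracket with `lo ≤ 0 ≤ hi` decides no
  sign: no energy theorem for that case, the absence is the statement).
* §2 THRESHOLD decisions for a query threshold `τ` (e.g. «is the step downhill by more than θ?»):
  `DiffUpperRow.energyDiff_lt_of_lt` (`hi < τ` ⇒ `ΔE < τ`), `DiffLowerRow.lt_energyDiff_of_lt`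
  (`τ < lo` ⇒ `τ < ΔE`), and the two-model transfer `DiffBracket.decides` (either `hi < τ` or `τ < lo`
  ⇒ the comparison of `ΔE` with `τ` is settled, with the answer).
* §3 CONFIDENCE-CLASS ARITHMETIC (ORACLE-SPEC §1.5; the class is a label on the ROW, these are the
  decidable slot facts it rests on): `IsInformativeWidth lo hi θ := hi − lo ≤ θ`,
  `DiffBracket.abs_sub_midpoint_le` (every certified ΔE lies within `(hi − lo)/2` of the midpoint; with an
  informative width, within `θ/2`), `isInformativeWidth_from_absolutes_iff` (a `dE-from-absolutes`
  bracket is informative iff `W_A + W_B ≤ θ`), `IsInformativeWidth.mono/.of_tighter`, and the EVENT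
  reading `not_refInside_of_lt_or_lt` vs `DiffBracket.energyDiff_mem_Icc` (a same-model FLOAT reference
  outside a certified bracket is a fact about the float, never about the certificate: the certified `ΔE`
  itself is always inside).
Thresholds of record (ORACLE-SPEC §2.4, docstring only; rationals in mE_h): 8.0 mE_h thermal step,
3.7 electrochemical, 1.8 migration, 1.6 calibration. Nothing here fixes `θ`; every statement is
universally quantified in it.
-/

noncomputable section

namespace Summit.Ventures.CertifiedQuantumChemistry

variable {kA kB : ℕ} {FA : Model kA} {FB : Model kB} {a b a' b' : ℕ} {lo hi : ℚ}

/-! ## §1 Sign / ordering of the two model energies -/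

/-- **ORDERING CERTIFIED, lower side**: a difference lower row with a POSITIVE slot, `0 < lo ≤
E₀(F_A; a,b) − E₀(F_B; a′,b′)`, certifies `E₀(F_B; a′, b′) < E₀(F_A; a, b)` — file B's sector ground
state lies strictly below file A's (the «isomer B more stable than isomer A IN THE MODEL» reading of a
`site-isomer` row). The SAME-FILE two-sector special case (`F_A = F_B`, a spin / charge gap) is
chem-type-06's `DiffLowerRow.energy_lt_of_pos` (`Rows/SpinLadderDifferenceRows.lean`); this is the
two-file form. -/
theorem DiffLowerRow.lt_of_pos (h : DiffLowerRow FA a b FB a' b' lo) (hlo : 0 < lo) :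
    FB.energy a' b' < FA.energy a b := by
  have h1 := h.2.2
  have h2 : (0 : ℝ) < ((lo : ℚ) : ℝ) := by exact_mod_cast hlo
  linarith

/-- Non-strict form: `0 ≤ lo` certifies `E₀(F_B; a′, b′) ≤ E₀(F_A; a, b)`. -/
theorem DiffLowerRow.le_of_nonneg (h : DiffLowerRow FA a b FB a' b' lo) (hlo : 0 ≤ lo) :
    FB.energy a' b' ≤ FA.energy a b := by
  have h1 := h.2.2
  have h2 : (0 : ℝ) ≤ ((lo : ℚ) : ℝ) := by exact_mod_cast hlo
  linarith

/-- **ORDERING CERTIFIED, upper side**: a difference upper row with a NEGATIVE slot,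
`E₀(F_A) − E₀(F_B) ≤ hi < 0`, certifies `E₀(F_A; a, b) < E₀(F_B; a′, b′)`. -/
theorem DiffUpperRow.lt_of_neg (h : DiffUpperRow FA a b FB a' b' hi) (hhi : hi < 0) :
    FA.energy a b < FB.energy a' b' := by
  have h1 := h.2.2
  have h2 : ((hi : ℚ) : ℝ) < 0 := by exact_mod_cast hhi
  linarith

/-- Non-strict form: `hi ≤ 0` certifies `E₀(F_A; a, b) ≤ E₀(F_B; a′, b′)`. -/
theorem DiffUpperRow.le_of_nonpos (h : DiffUpperRow FA a b FB a' b' hi) (hhi : hi ≤ 0) :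
    FA.energy a b ≤ FB.energy a' b' := by
  have h1 := h.2.2
  have h2 : ((hi : ℚ) : ℝ) ≤ 0 := by exact_mod_cast hhi
  linarith

/-- The sign decisions read off a two-sided row: `0 < lo` ⇒ B below A. -/
theorem DiffBracket.lt_of_pos (h : DiffBracket FA a b FB a' b' lo hi) (hlo : 0 < lo) :
    FB.energy a' b' < FA.energy a b :=
  h.1.lt_of_pos hlo

/-- The sign decisions read off a two-sided row: `hi < 0` ⇒ A below B. -/
theorem DiffBracket.lt_of_neg (h : DiffBracket FA a b FB a' b' lo hi) (hhi : hi < 0) :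
    FA.energy a b < FB.energy a' b' :=
  h.2.lt_of_neg hhi

/-- **A bracket STRADDLING zero decides no sign** — the name of the case `lo ≤ 0 ≤ hi` (a decidable
fact about the two slots; the oracle then answers the ordering query `undetermined` at this level and
escalates the condition set / the upper state). No energy statement follows from it and none is made. -/
def DiffBracket.StraddlesZero (lo hi : ℚ) : Prop := lo ≤ 0 ∧ 0 ≤ hi

/-- The three cases are exhaustive for a consistent bracket (`lo ≤ hi`): the sign is certified positive,
certified negative, or the bracket straddles zero. -/
theorem DiffBracket.sign_trichotomy (h : DiffBracket FA a b FB a' b' lo hi) :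
    0 < lo ∨ hi < 0 ∨ DiffBracket.StraddlesZero lo hi := by
  have hle := h.lo_le_hi
  unfold DiffBracket.StraddlesZero
  rcases lt_or_ge 0 lo with h1 | h1
  · exact Or.inl h1
  · rcases lt_or_ge hi 0 with h2 | h2
    · exact Or.inr (Or.inl h2)
    · exact Or.inr (Or.inr ⟨h1, h2⟩)

/-! ## §2 Threshold decisions (query: compare `ΔE` with a rational threshold `τ`) -/

/-- **`ΔE < τ` CERTIFIED** from an upper slot below the threshold. -/
theorem DiffUpperRow.energyDiff_lt_of_lt (h : DiffUpperRow FA a b FB a' b' hi) {τ : ℚ} (hτ : hi < τ) :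
    FA.energyDiff a b FB a' b' < ((τ : ℚ) : ℝ) := by
  have h1 := h.2.2
  have h2 : ((hi : ℚ) : ℝ) < ((τ : ℚ) : ℝ) := by exact_mod_cast hτ
  unfold Model.energyDiff
  linarith

/-- **`τ < ΔE` CERTIFIED** from a lower slot above the threshold. -/
theorem DiffLowerRow.lt_energyDiff_of_lt (h : DiffLowerRow FA a b FB a' b' lo) {τ : ℚ} (hτ : τ < lo) :
    ((τ : ℚ) : ℝ) < FA.energyDiff a b FB a' b' := by
  have h1 := h.2.2
  have h2 : ((τ : ℚ) : ℝ) < ((lo : ℚ) : ℝ) := by exact_mod_cast hτ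
  unfold Model.energyDiff
  linarith

/-- **A threshold query is DECIDED by a bracket that does not contain the threshold**: if `hi < τ` the
answer is `ΔE < τ`, if `τ < lo` the answer is `τ < ΔE` (the disjunction carries which). A bracket with
`lo ≤ τ ≤ hi` decides nothing about `τ` (no theorem). -/
theorem DiffBracket.decides (h : DiffBracket FA a b FB a' b' lo hi) {τ : ℚ} (hτ : hi < τ ∨ τ < lo) :
    FA.energyDiff a b FB a' b' < ((τ : ℚ) : ℝ) ∨ ((τ : ℚ) : ℝ) < FA.energyDiff a b FB a' b' := by
  rcases hτ with h1 | h1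
  · exact Or.inl (h.2.energyDiff_lt_of_lt h1)
  · exact Or.inr (h.1.lt_energyDiff_of_lt h1)

/-! ## §3 Confidence-class arithmetic (ORACLE-SPEC §1.5): width against the decision threshold -/

/-- **INFORMATIVE WIDTH** (the slot fact behind the label `certified-informative` of ORACLE-SPEC §1.5:
«a two-sided certified bracket on ΔE_model with width ≤ the query's decision threshold θ»): the
bracket `[lo, hi]` has width at most `θ`. Decidable on the three rationals (`norm_num` / `decide`);
a predicate on slots, never on energies; the LABEL is the referee's, this is its arithmetic. -/
def IsInformativeWidth (lo hi θ : ℚ) : Prop := hi - lo ≤ θ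

/-- Unfolding lemma for `IsInformativeWidth`. -/
theorem isInformativeWidth_iff (lo hi θ : ℚ) : IsInformativeWidth lo hi θ ↔ hi - lo ≤ θ := Iff.rfl

/-- **Every certified `ΔE` lies within half the width of the bracket's midpoint**:
`|ΔE − (lo + hi)/2| ≤ (hi − lo)/2` (the midpoint is a convenience number, NOT a certified value; the
certified object is the interval). -/
theorem DiffBracket.abs_sub_midpoint_le (h : DiffBracket FA a b FB a' b' lo hi) :
    |FA.energyDiff a b FB a' b' - (((lo + hi) / 2 : ℚ) : ℝ)| ≤ (((hi - lo) / 2 : ℚ) : ℝ) := by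
  have h1 := h.1.2.2
  have h2 := h.2.2.2
  unfold Model.energyDiff
  push_cast
  rw [abs_le]
  constructor <;> linarith

/-- With an informative width the midpoint reading is `θ/2`-accurate: `|ΔE − mid| ≤ θ/2`. -/
theorem DiffBracket.abs_sub_midpoint_le_of_informative (h : DiffBracket FA a b FB a' b' lo hi) {θ : ℚ}
    (hθ : IsInformativeWidth lo hi θ) :
    |FA.energyDiff a b FB a' b' - (((lo + hi) / 2 : ℚ) : ℝ)| ≤ ((θ / 2 : ℚ) : ℝ) := by
  refine le_trans h.abs_sub_midpoint_le ?_
  have : (hi - lo) / 2 ≤ θ / 2 := by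
    unfold IsInformativeWidth at hθ
    linarith
  exact_mod_cast this

/-- **A `dE-from-absolutes` bracket is informative iff the two absolute widths together fit the
threshold**: `IsInformativeWidth (L_A − U_B) (U_A − L_B) θ ↔ (U_A − L_A) + (U_B − L_B) ≤ θ`
(`width_from_absolutes`). The arithmetic behind «R2 via absolutes needs W_A + W_B ≤ θ». -/
theorem isInformativeWidth_from_absolutes_iff (loA hiA loB hiB θ : ℚ) :
    IsInformativeWidth (loA - hiB) (hiA - loB) θ ↔ (hiA - loA) + (hiB - loB) ≤ θ := by
  unfold IsInformativeWidth
  rw [width_from_absolutes]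

/-- An informative width is monotone in the threshold. -/
theorem IsInformativeWidth.mono {lo hi θ θ' : ℚ} (h : IsInformativeWidth lo hi θ) (hle : θ ≤ θ') :
    IsInformativeWidth lo hi θ' :=
  le_trans h hle

/-- Tightening either slot keeps a width informative: `lo ≤ lo′`, `hi′ ≤ hi`. -/
theorem IsInformativeWidth.of_tighter {lo hi lo' hi' θ : ℚ} (h : IsInformativeWidth lo hi θ)
    (hlo : lo ≤ lo') (hhi : hi' ≤ hi) : IsInformativeWidth lo' hi' θ := by
  unfold IsInformativeWidth at h ⊢
  linarith

/-- **A reference number outside a certified bracket is an event about the REFERENCE** (REFEREE-CHEM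
R4: «a number a certified bound contradicts in print is reported as a fact about the print»): if the
same-model float `ref` satisfies `ref < lo` or `hi < ref`, then `¬ RefInside lo hi ref` — and by
`DiffBracket` the certified `ΔE` itself IS inside, so the float, not the certificate, is off. -/
theorem not_refInside_of_lt_or_lt {ref : ℚ} (h : ref < lo ∨ hi < ref) : ¬ RefInside lo hi ref := by
  rintro ⟨h1, h2⟩
  rcases h with h3 | h3
  · exact absurd h1 (not_le.2 h3)
  · exact absurd h2 (not_le.2 h3)

/-- The certified difference itself always lies in its bracket (as a real interval): the consistency
fact the previous lemma is contrasted with. -/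
theorem DiffBracket.energyDiff_mem_Icc (h : DiffBracket FA a b FB a' b' lo hi) :
    FA.energyDiff a b FB a' b' ∈ Set.Icc (((lo : ℚ) : ℝ)) (((hi : ℚ) : ℝ)) :=
  ⟨h.1.le, h.2.le⟩

end Summit.Ventures.CertifiedQuantumChemistry

end
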